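import Summits.Ventures.LatticeQCDFlow.Scaling.ReplicaExchangeModeTorpid
import Literature.Probability.MarkovChains.SpectralGapTestFunction

/-!
HONEST FRAMING: exact (Metropolis-corrected) sampling algorithms for lattice gauge theory; figures
of merit are autocorrelation/cost numbers at stated couplings and volumes; no continuum-physics
claim.

# ReplicaExchangeCommonMode — REPLICA EXCHANGE INHERITS EVERY SLOW MODE COMMON TO ALL ITS LEVELS: FOR EVERY OBSERVABLE
# `h` OF A CONFIGURATION, THE LEVEL-CENTRED SUM `G = Σ_k (h(x_k) − E_{μ_k}h)` IS INVISIBLE TO SWAPS AND HAS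
# `𝓔_P(G) = ((1−t)/(K+1))Σ_k 𝓔_{μ_k}(M_k;h)`, SO `Gap ≤ (1−t)Σ_k𝓔_k(h)/((K+1)Σ_k Var_k(h))`; IF `h` IS `ε`-SLOW AT EVERY
# LEVEL, `Gap ≤ (1−t)ε/(K+1)` AND `τ_int(G) ≥ (K+1)/((1−t)ε) − ½` (lean-2 GEN-17, ours)

Venture-side (OURS).  Cell `lqcd-flow` (pub-lqcd), unit `pub-lqcd-lean-2-g17`, 2026-08-25.  The replica-exchange
companion of `Scaling/SimulatedTemperingCommonMode`, in the setting of `Scaling/ReplicaExchangeFiniteSampler`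
(state `(τ, x)`, `x : Fin (K+1) → S` one configuration per level, target `ptFinLaw μ`, sampler
`P = ptFinSampler t μ M = t·ptFinSwap μ + (1−t)·ptFinUpdate M`), with the product-law tools of
`Scaling/ReplicaExchangeModeTorpid`.

## What is proved

* §1 **`ptFin_dirichletForm_swap_of_invariant`** — an observable invariant under every swap `swapAct j` has
  `𝓔_{Sw} = 0`; **`ptFin_dirichletForm_update_comp_snd`** — for an observable of the configurations only,
  `𝓔_{π}(ptFinUpdate M; F∘snd) = 𝓔_{π̃}(prodKernel (1/(K+1)) M; F)`; `ptFin_dirichletForm_sampler_comp_snd` — linearity.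
* §2 the level-centred sum `G(τ,x) = Σ_k (h(x_k) − E_{μ_k} h)`: `levelCentredSum_swapAct` (swap-invariant),
  **`ptFin_dirichletForm_levelCentredSum`** — `𝓔_P(G) = ((1−t)/(K+1))·Σ_k 𝓔_{μ_k}(M_k; h)` EXACTLY,
  `ptFin_piInner_levelCentredSum` — `‖G‖²_π = Σ_k Var_{μ_k}(h)`, `ptFin_mean_levelCentredSum` — `E_π G = 0`.
* §3 **`ptFin_spectralGap_le_commonMode`** — `Gap(P) ≤ (1−t)·Σ_k 𝓔_{μ_k}(M_k;h)/((K+1)·Σ_k Var_{μ_k}(h))`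
  (`0 ≤ t ≤ 1`, `K ≥ 1`, `Σ_k Var_k(h) > 0`); **`ptFin_spectralGap_le_of_slow`** — `ε`-slow at every level ⇒
  `Gap(P) ≤ (1−t)ε/(K+1)` per step (`= (1−t)ε` per sweep of `K+1` single-replica updates);
  **`ptFin_tauInt_levelCentredSum_ge`** — irreducible sampler ⇒
  `τ_int(G) ≥ (K+1)·Σ_k Var_k(h)/((1−t)·Σ_k 𝓔_k(h)) − ½`.

Reading (no numerics implied): as for simulated tempering, swapping replicas between couplings cannot relax an
observable faster than the within-replica updates relax it at the levels, summed over the ladder: replica exchange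
helps only with bottlenecks that some level does not have.  NOT CLAIMED: the positive direction for replica exchange;
general configuration spaces; anything measured.  Literature grade (cell rule): KNOWN MECHANISM (test-function gap
ceilings; Woodard–Schmidler–Huber 2009, Bhatnagar–Randall 2004), NEW TYPING; nothing cited as a fact; no new bib keys.
-/

noncomputable section

open Finset Function
open Literature.Probability.MarkovChains

namespace Summit.Ventures.LatticeQCDFlow.Scaling

variable {S : Type*} [Fintype S] [DecidableEq S] {K : ℕ} {μ : Fin (K + 1) → S → ℝ}
  {M : Fin (K + 1) → S → S → ℝ} {t : ℝ}

/-! ## §1 Swap-invariant observables; observables of the configurations -/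

/-- **An observable invariant under every swap has vanishing swap Dirichlet form.** [ours] -/
theorem ptFin_dirichletForm_swap_of_invariant (hμ : ∀ k x, 0 < μ k x) (G : Fin (K + 1) × (Fin (K + 1) → S) → ℝ)
    (hG : ∀ (j : Fin K) (p : Fin (K + 1) × (Fin (K + 1) → S)), G (swapAct j p) = G p) :
    dirichletForm (ptFinLaw μ) (ptFinSwap μ) G = 0 := by
  unfold dirichletForm
  rw [mul_eq_zero]
  refine Or.inr (Finset.sum_eq_zero fun p _ => Finset.sum_eq_zero fun q _ => ?_)
  by_cases hqp : q = p
  · rw [hqp, sub_self]; ring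
  · rw [ptFinLaw_mul_ptFinSwap hμ hqp]
    unfold ptFinProposal
    rw [Finset.sum_mul, Finset.sum_mul]
    refine Finset.sum_eq_zero fun j _ => ?_
    split_ifs with hj
    · rw [hj, hG j p, sub_self]; ring
    · ring

/-- **For an observable of the configurations only, the replica update's Dirichlet form is the product chain's.**
[ours] -/
theorem ptFin_dirichletForm_update_comp_snd (F : (Fin (K + 1) → S) → ℝ) :
    dirichletForm (ptFinLaw μ) (ptFinUpdate M) (fun p => F p.2)
      = dirichletForm (tensorFun μ) (prodKernel (fun _ : Fin (K + 1) => (1 : ℝ) / (K + 1)) M) F := by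
  unfold dirichletForm
  congr 1
  have inner : ∀ p : Fin (K + 1) × (Fin (K + 1) → S),
      ∑ q : Fin (K + 1) × (Fin (K + 1) → S), ptFinLaw μ p * ptFinUpdate M p q * (F p.2 - F q.2) ^ 2
        = ptFinLaw μ p * ∑ y, prodKernel (fun _ : Fin (K + 1) => (1 : ℝ) / (K + 1)) M p.2 y * (F p.2 - F y) ^ 2 := by
    intro p
    rw [Fintype.sum_prod_type, Finset.mul_sum]
    simp_rw [ptFinUpdate_apply]
    rw [Finset.sum_eq_single p.1 (fun τ _ hτ => by simp [hτ]) (fun h => absurd (mem_univ _) h)]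
    simp only [if_true]
    exact sum_congr rfl fun y _ => by ring
  simp_rw [inner]
  rw [sum_ptFinLaw_mul_snd (μ := μ) (fun x => ∑ y, prodKernel (fun _ : Fin (K + 1) => (1 : ℝ) / (K + 1)) M x y
    * (F x - F y) ^ 2)]
  refine sum_congr rfl fun x _ => ?_
  rw [Finset.mul_sum]
  exact sum_congr rfl fun y _ => by ring

/-- Linearity of the sampler's Dirichlet form in the two moves. [ours] -/
theorem ptFin_dirichletForm_sampler (G : Fin (K + 1) × (Fin (K + 1) → S) → ℝ) :
    dirichletForm (ptFinLaw μ) (ptFinSampler t μ M) G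
      = t * dirichletForm (ptFinLaw μ) (ptFinSwap μ) G + (1 - t) * dirichletForm (ptFinLaw μ) (ptFinUpdate M) G := by
  unfold dirichletForm
  rw [← mul_assoc, ← mul_assoc, mul_comm t, mul_comm (1 - t), mul_assoc, mul_assoc, ← mul_add]
  congr 1
  rw [Finset.mul_sum, Finset.mul_sum, ← Finset.sum_add_distrib]
  refine sum_congr rfl fun p _ => ?_
  rw [Finset.mul_sum, Finset.mul_sum, ← Finset.sum_add_distrib]
  refine sum_congr rfl fun q _ => ?_
  rw [ptFinSampler_apply]
  ring

/-! ## §2 The level-centred sum of a configuration observable -/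

omit [DecidableEq S] in
/-- **The level-centred sum `Σ_k (h(x_k) − E_{μ_k}h)` is invariant under every swap** (a swap permutes the
summands `h(x_k)`; the centring constants only enter through their total). [ours] -/
theorem levelCentredSum_swapAct (h : S → ℝ) (j : Fin K) (p : Fin (K + 1) × (Fin (K + 1) → S)) :
    ∑ k, (h ((swapAct j p).2 k) - lawMean (μ k) h) = ∑ k, (h (p.2 k) - lawMean (μ k) h) := by
  rw [Finset.sum_sub_distrib, Finset.sum_sub_distrib]
  congr 1
  unfold swapAct
  exact Equiv.sum_comp (levelSwap j) (fun i => h (p.2 i))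

/-- **`𝓔_P(G) = ((1−t)/(K+1))·Σ_k 𝓔_{μ_k}(M_k; h)` exactly** for the level-centred sum. [ours] -/
theorem ptFin_dirichletForm_levelCentredSum (hμ : ∀ k x, 0 < μ k x) (hμ1 : ∀ k, ∑ u, μ k u = 1) (h : S → ℝ) :
    dirichletForm (ptFinLaw μ) (ptFinSampler t μ M) (fun p => ∑ k, (h (p.2 k) - lawMean (μ k) h))
      = (1 - t) / (K + 1) * ∑ k, dirichletForm (μ k) (M k) h := by
  rw [ptFin_dirichletForm_sampler,
    ptFin_dirichletForm_swap_of_invariant hμ _ (fun j p => levelCentredSum_swapAct (μ := μ) h j p), mul_zero,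
    zero_add,
    ptFin_dirichletForm_update_comp_snd (μ := μ) (M := M) (fun x => ∑ k, (h (x k) - lawMean (μ k) h)),
    dirichletForm_prodKernel_additive μ hμ1 _ M (fun k u => h u - lawMean (μ k) h), ← Finset.mul_sum,
    show (1 - t) / ((K : ℝ) + 1) * ∑ k, dirichletForm (μ k) (M k) h
      = (1 - t) * (1 / (K + 1) * ∑ k, dirichletForm (μ k) (M k) h) by ring]
  congr 1
  congr 1
  refine sum_congr rfl fun k _ => ?_
  exact dirichletForm_sub_const _ _ _ _

omit [DecidableEq S] in
/-- The level-centred sum is centred: `E_π G = 0`. [ours] -/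
theorem ptFin_mean_levelCentredSum [DecidableEq S] (hμ1 : ∀ k, ∑ u, μ k u = 1) (h : S → ℝ) :
    ∑ p : Fin (K + 1) × (Fin (K + 1) → S), ptFinLaw μ p * ∑ k, (h (p.2 k) - lawMean (μ k) h) = 0 := by
  rw [sum_ptFinLaw_mul_snd (μ := μ) (fun x => ∑ k, (h (x k) - lawMean (μ k) h)),
    sum_tensorFun_mul_additive μ hμ1 (fun k u => h u - lawMean (μ k) h)]
  refine Finset.sum_eq_zero fun k _ => ?_
  exact sum_mul_sub_lawMean (hμ1 k) h

omit [DecidableEq S] in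
/-- **`‖G‖²_π = Σ_k Var_{μ_k}(h)`** for the level-centred sum. [ours] -/
theorem ptFin_piInner_levelCentredSum (hμ1 : ∀ k, ∑ u, μ k u = 1) (h : S → ℝ) :
    piInner (ptFinLaw μ) (fun p => ∑ k, (h (p.2 k) - lawMean (μ k) h)) (fun p => ∑ k, (h (p.2 k) - lawMean (μ k) h))
      = ∑ k, lawVariance (μ k) h := by
  unfold piInner
  rw [sum_ptFinLaw_mul_snd (μ := μ)
    (fun x => (∑ k, (h (x k) - lawMean (μ k) h)) * ∑ k, (h (x k) - lawMean (μ k) h))]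
  have hg := piInner_tensorFun_additive μ hμ1 (fun k u => h u - lawMean (μ k) h)
    (fun k => sum_mul_sub_lawMean (hμ1 k) h)
  unfold piInner at hg
  rw [hg]
  refine sum_congr rfl fun k _ => ?_
  unfold lawVariance
  exact sum_congr rfl fun u _ => by ring

/-! ## §3 The spectral-gap ceiling and the autocorrelation floor -/

/-- **THE COMMON-MODE CEILING FOR REPLICA EXCHANGE: `Gap(P) ≤ (1−t)·Σ_k 𝓔_{μ_k}(M_k; h)/((K+1)·Σ_k Var_{μ_k}(h))`**
for every observable `h` of a configuration with `Σ_k Var_{μ_k}(h) > 0` (`0 ≤ t ≤ 1`, `K ≥ 1`). [ours] -/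
theorem ptFin_spectralGap_le_commonMode (hK : 1 ≤ K) (hμ : ∀ k x, 0 < μ k x) (hμ1 : ∀ k, ∑ u, μ k u = 1)
    (hM : ∀ k, IsRowStochastic (M k)) (hMrev : ∀ k, DetailedBalance (μ k) (M k)) (ht0 : 0 ≤ t) (ht1 : t ≤ 1)
    (h : S → ℝ) (hV : 0 < ∑ k, lawVariance (μ k) h) :
    spectralGap (ptFinLaw μ) (ptFinSampler t μ M)
      ≤ (1 - t) * (∑ k, dirichletForm (μ k) (M k) h) / ((K + 1) * ∑ k, lawVariance (μ k) h) := by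
  haveI : Nonempty S := ⟨Classical.choice (by
    by_contra hS
    rw [not_nonempty_iff] at hS
    have := hμ1 0
    rw [Finset.univ_eq_empty, Finset.sum_empty] at this
    exact zero_ne_one this)⟩
  haveI : Nontrivial (Fin (K + 1)) := Fin.nontrivial_iff_two_le.mpr (by omega)
  have hP := ptFinSampler_isRowStochastic (M := M) hμ hM ht0 ht1
  have hDB := ptFinSampler_detailedBalance (t := t) (M := M) hμ hMrev
  have hray := LevinPeres2017_lemma_13_7_rayleigh (ptFinLaw_pos hμ) (sum_ptFinLaw hμ1) hP hDB
    (ptFin_mean_levelCentredSum (μ := μ) hμ1 h)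
  rw [ptFin_piInner_levelCentredSum hμ1, ptFin_dirichletForm_levelCentredSum hμ hμ1] at hray
  have hK1 : (0 : ℝ) < K + 1 := by positivity
  rw [le_div_iff₀ (by positivity)]
  calc spectralGap (ptFinLaw μ) (ptFinSampler t μ M) * ((K + 1) * ∑ k, lawVariance (μ k) h)
      = (K + 1) * (spectralGap (ptFinLaw μ) (ptFinSampler t μ M) * ∑ k, lawVariance (μ k) h) := by ring
    _ ≤ (K + 1) * ((1 - t) / (K + 1) * ∑ k, dirichletForm (μ k) (M k) h) := mul_le_mul_of_nonneg_left hray hK1.le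
    _ = (1 - t) * ∑ k, dirichletForm (μ k) (M k) h := by field_simp

/-- **An observable that is `ε`-slow at EVERY level makes replica exchange `(1−t)ε/(K+1)`-slow per step** (one of the
`K+1` replicas is updated per step). [ours] -/
theorem ptFin_spectralGap_le_of_slow (hK : 1 ≤ K) (hμ : ∀ k x, 0 < μ k x) (hμ1 : ∀ k, ∑ u, μ k u = 1)
    (hM : ∀ k, IsRowStochastic (M k)) (hMrev : ∀ k, DetailedBalance (μ k) (M k)) (ht0 : 0 ≤ t) (ht1 : t ≤ 1)
    (h : S → ℝ) {ε : ℝ} (hslow : ∀ k, dirichletForm (μ k) (M k) h ≤ ε * lawVariance (μ k) h)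
    (hV : 0 < ∑ k, lawVariance (μ k) h) :
    spectralGap (ptFinLaw μ) (ptFinSampler t μ M) ≤ (1 - t) * ε / (K + 1) := by
  refine (ptFin_spectralGap_le_commonMode hK hμ hμ1 hM hMrev ht0 ht1 h hV).trans ?_
  have hK1 : (0 : ℝ) < K + 1 := by positivity
  have hSE : ∑ k, dirichletForm (μ k) (M k) h ≤ ε * ∑ k, lawVariance (μ k) h := by
    rw [Finset.mul_sum]; exact sum_le_sum fun k _ => hslow k
  rw [div_le_div_iff₀ (by positivity) hK1]
  have h1t : 0 ≤ 1 - t := by linarith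
  calc (1 - t) * (∑ k, dirichletForm (μ k) (M k) h) * (K + 1)
      ≤ (1 - t) * (ε * ∑ k, lawVariance (μ k) h) * (K + 1) :=
        mul_le_mul_of_nonneg_right (mul_le_mul_of_nonneg_left hSE h1t) hK1.le
    _ = (1 - t) * ε * ((K + 1) * ∑ k, lawVariance (μ k) h) := by ring

/-- **THE LEVEL-CENTRED SUM STAYS CORRELATED:** for an irreducible sampler (`0 ≤ t < 1`),
`τ_int(G) = asympVar/(2Var) ≥ (K+1)·Σ_k Var_{μ_k}(h)/((1−t)·Σ_k 𝓔_{μ_k}(M_k;h)) − ½`. [ours] -/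
theorem ptFin_tauInt_levelCentredSum_ge (hμ : ∀ k x, 0 < μ k x) (hμ1 : ∀ k, ∑ u, μ k u = 1)
    (hM : ∀ k, IsRowStochastic (M k)) (hMrev : ∀ k, DetailedBalance (μ k) (M k)) (ht0 : 0 ≤ t) (ht1 : t < 1)
    (hirr : IsIrreducible (ptFinSampler t μ M)) (h : S → ℝ) (hV : 0 < ∑ k, lawVariance (μ k) h) :
    (K + 1) * (∑ k, lawVariance (μ k) h) / ((1 - t) * ∑ k, dirichletForm (μ k) (M k) h) - 1 / 2
      ≤ asympVar (fun p => ∑ k, (h (p.2 k) - lawMean (μ k) h)) (ptFinLaw μ) (ptFinSampler t μ M)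
          / (2 * lawVariance (ptFinLaw μ)
              (fun p : Fin (K + 1) × (Fin (K + 1) → S) => ∑ k, (h (p.2 k) - lawMean (μ k) h))) := by
  set G : Fin (K + 1) × (Fin (K + 1) → S) → ℝ := fun p => ∑ k, (h (p.2 k) - lawMean (μ k) h) with hG
  have hP := ptFinSampler_isRowStochastic (M := M) hμ hM ht0 ht1.le
  have hDB := ptFinSampler_detailedBalance (t := t) (M := M) hμ hMrev
  have hst : IsStationary (ptFinLaw μ) (ptFinSampler t μ M) := hDB.isStationary hP.2
  have hπ := ptFinLaw_pos (K := K) hμ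
  have hπ1 := sum_ptFinLaw (K := K) hμ1
  have hmean : lawMean (ptFinLaw μ) G = 0 := ptFin_mean_levelCentredSum (μ := μ) hμ1 h
  have hVar : lawVariance (ptFinLaw μ) G = ∑ k, lawVariance (μ k) h := by
    rw [← ptFin_piInner_levelCentredSum hμ1 h]
    unfold lawVariance piInner
    rw [hmean]
    exact sum_congr rfl fun p _ => by ring
  have hE : dirichletForm (ptFinLaw μ) (ptFinSampler t μ M) G = (1 - t) / (K + 1) * ∑ k, dirichletForm (μ k) (M k) h :=
    ptFin_dirichletForm_levelCentredSum hμ hμ1 h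
  have key := asympVar_mul_dirichletForm_ge hπ hπ1 hP hDB hirr G
  have h928 := MadrasSlade1993_eq_9_2_28 hP hst G
  set V := lawVariance (ptFinLaw μ) G with hVdef
  set C1 := piInner (ptFinLaw μ) (centred (ptFinLaw μ) G) ((ptFinSampler t μ M).mulVec (centred (ptFinLaw μ) G))
  set v := asympVar G (ptFinLaw μ) (ptFinSampler t μ M)
  set E := dirichletForm (ptFinLaw μ) (ptFinSampler t μ M) G with hEdef
  have hC1E : C1 = V - E := by linarith
  rw [hC1E] at key
  have hVpos : 0 < V := by rw [hVar]; exact hV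
  have hEpos : 0 < E := by
    by_contra hc
    push Not at hc
    have hE0 : E = 0 := le_antisymm hc (dirichletForm_nonneg (fun p => (hπ p).le) hP.1 _)
    rw [hE0, sub_zero] at key
    nlinarith
  have hK1 : (0 : ℝ) < K + 1 := by positivity
  have hSE : 0 < ∑ k, dirichletForm (μ k) (M k) h := by
    rw [hE] at hEpos
    exact (mul_pos_iff_of_pos_left (div_pos (by linarith) hK1)).mp hEpos
  have eL : (K + 1) * (∑ k, lawVariance (μ k) h) / ((1 - t) * ∑ k, dirichletForm (μ k) (M k) h) = V / E := by
    rw [hVar, hE]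
    have h1t : (1 - t) ≠ 0 := by linarith
    field_simp
  rw [eL]
  have e : V / E - 1 / 2 = (2 * V - E) / (2 * E) := by field_simp
  rw [e, div_le_div_iff₀ (by positivity) (by positivity)]
  nlinarith [key]

end Summit.Ventures.LatticeQCDFlow.Scaling

end
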